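import Mathlib.LinearAlgebra.Matrix.ToLinearEquiv
import Mathlib.LinearAlgebra.Matrix.Block
import Mathlib.RingTheory.PowerSeries.Trunc
import Mathlib.Data.Fin.Rev
import Mathlib.Tactic
import HarnessLib

/-!
# Kronecker's rationality criterion (Hankel determinants), Salem's form

A power series `f = Σ aₙ xⁿ` over a field is rational as soon as its anchored Hankel
determinants `Δₘ = det (a_{i+j})_{0 ≤ i,j ≤ m}` vanish for all large `m` (Kronecker 1881). This is
the algebraic half of every *Borel–Dwork–Pólya* rationality proof — the arithmetic-analytic
rigidity theorems that Calegari–Dimitrov–Tang (arXiv:2408.15403) take as the point of departure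
of their arithmetic holonomy bounds (their §1.2 Lemma 2 / Theorem 3 (Borel–Pólya) and §2.1):
analysis makes the integers `Δₘ` small, hence zero, and Kronecker's criterion turns
`Δₘ = 0 (m ≥ m₁)` into a linear recurrence, i.e. rationality.

We follow Salem's half-page proof (R. Salem, *Algebraic numbers and Fourier analysis*, 1963,
Ch. I §1, Lemma (Kronecker)): let `p` be least with `Δₘ = 0` for all `m ≥ p`; if `p = 0` the
sequence vanishes identically (an anti-triangular determinant computation); otherwise
`Δ_{p−1} ≠ 0`, the rows of the `(p+1) × (p+1)` Hankel matrix give coefficients `α₀,…,α_p`,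
`α_p = 1`, with `L_j := Σ αᵢ a_{i+j} = 0` for `j ≤ p`, and unit-lower-triangular row operations
put the `(p+k+1) × (p+k+1)` Hankel matrix in block form `[[Δ_{p−1}-block, *], [0, anti-triangular
with L_{p+k} on the anti-diagonal]]`, so `0 = Δ_{p+k} = ± Δ_{p−1} L_{p+k}^{k+1}` forces
`L_{p+k} = 0` inductively: a linear recurrence of order `p`.

## Contents (all proved; no named facts)

* `Kronecker.hankelMatrix a m`, `Kronecker.hankelDet a m` — `(a_{i+j})_{0≤i,j≤m}` and `Δₘ`.
* `Kronecker.eq_zero_of_det_antitriangular` — the anti-triangular determinant step.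
* `Kronecker.elimination_step` — Salem's block-triangular elimination.
* `Kronecker.exists_recurrence_of_hankelDet_eq_zero` — **Kronecker's criterion** (recurrence
  form): `Δₘ = 0` for `m ≥ m₁` ⟹ `∃ p, α` with `α_p = 1`, `Σ_{i ≤ p} αᵢ a_{i+j} = 0` for all `j`.
* `Kronecker.exists_polynomial_mul_eq_of_hankelDet_eq_zero` — rationality form:
  `∃ Q, Q(0)… ≠ 0`-free: `∃ Q ≠ 0, P ∈ K[x]` with `Q · f = P` in `K⟦x⟧`.

Only the sufficiency direction (the one used in rationality proofs) is formalised here.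

## References

* L. Kronecker, *Zur Theorie der Elimination einer Variabeln aus zwei algebraischen
  Gleichungen*, Monatsber. Akad. Berlin (1881) 535–600.
* R. Salem, *Algebraic numbers and Fourier analysis*, Heath 1963, Ch. I §1 (Kronecker's lemma).
* [CalegariDimitrovTang2024] arXiv:2408.15403, §1.2 (Lemma 2, Theorem 3), §2.1.
-/

open Finset Matrix

namespace Literature.NumberTheory.Transcendental

namespace Kronecker

variable {K : Type*}

section CommRing

/-- The **anchored Hankel matrix** `(a_{i+j})_{0 ≤ i, j ≤ m}` of a sequence `a`. [folklore] -/
def hankelMatrix (a : ℕ → K) (m : ℕ) : Matrix (Fin (m + 1)) (Fin (m + 1)) K :=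
  Matrix.of fun i j => a ((i : ℕ) + j)

/-- Entries of the Hankel matrix. [folklore] -/
@[simp]
theorem hankelMatrix_apply (a : ℕ → K) (m : ℕ) (i j : Fin (m + 1)) :
    hankelMatrix a m i j = a ((i : ℕ) + j) :=
  rfl

variable [CommRing K]

/-- The **Hankel determinant** `Δₘ = det (a_{i+j})_{0 ≤ i, j ≤ m}`. [folklore] -/
def hankelDet (a : ℕ → K) (m : ℕ) : K :=
  (hankelMatrix a m).det

/-- `Δ₀ = a₀`. [folklore] -/
theorem hankelDet_zero (a : ℕ → K) : hankelDet a 0 = a 0 := by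
  simp [hankelDet, Matrix.det_unique]

end CommRing

section Field

variable [Field K]

/-- **The anti-triangular step.** If `M t u = c (t + u)` on `Fin (k+1)` and `c s = 0` for
`s < k`, then `M` is anti-triangular with `c k` along the anti-diagonal, so
`det M = ± (c k)^{k+1}`; in particular `det M = 0` forces `c k = 0`. [folklore] -/
theorem eq_zero_of_det_antitriangular {k : ℕ} (c : ℕ → K) (hc : ∀ s < k, c s = 0)
    (M : Matrix (Fin (k + 1)) (Fin (k + 1)) K) (hM : ∀ t u : Fin (k + 1), M t u = c (t + u))
    (hdet : M.det = 0) : c k = 0 := by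
  -- reverse the order of the columns: the result is lower triangular with diagonal `c k`
  set M' : Matrix (Fin (k + 1)) (Fin (k + 1)) K :=
    M.submatrix id (Fin.revPerm : Equiv.Perm (Fin (k + 1))) with hM'
  have hM'_apply : ∀ i j : Fin (k + 1), M' i j = c ((i : ℕ) + (k - j)) := by
    intro i j
    simp only [hM', Matrix.submatrix_apply, id, Fin.revPerm_apply, hM, Fin.val_rev]
    congr 1
    omega
  have hlow : M'.BlockTriangular OrderDual.toDual := by
    intro i j hij
    have hij' : i < j := OrderDual.toDual_lt_toDual.mp hij
    rw [hM'_apply]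
    apply hc
    have : (i : ℕ) < j := hij'
    have := j.isLt
    omega
  have hdiag : ∀ i : Fin (k + 1), M' i i = c k := by
    intro i
    rw [hM'_apply]
    congr 1
    have := i.isLt
    omega
  have hdet' : M'.det = c k ^ (k + 1) := by
    rw [Matrix.det_of_lowerTriangular M' hlow]
    simp [hdiag, Finset.prod_const]
  have hperm : M'.det = Equiv.Perm.sign (Fin.revPerm : Equiv.Perm (Fin (k + 1))) * M.det :=
    Matrix.det_permute' _ M
  rw [hdet, mul_zero, hdet'] at hperm
  exact (pow_eq_zero_iff (Nat.succ_ne_zero k)).mp hperm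

/-- **The elimination step** (Salem): with `α : Fin (q+2) → K`, `α_{q+1} = 1`, put
`L j := Σᵢ αᵢ a_{i+j}`. If `Δ_q ≠ 0`, `Δ_{q+1+k} = 0` and `L j = 0` for all `j < q+1+k`, then
`L (q+1+k) = 0`: unit lower-triangular row operations `rowᵢ ← Σ_t α_t row_{i−(q+1)+t}`
(`i ≥ q+1`) turn the Hankel matrix of size `q+k+2` into the block-triangular matrix
`[[(a_{i+j})_{i,j ≤ q}, *], [0, (L(q+1+t+u))_{t,u ≤ k}]]`, whose determinant is
`Δ_q · (± L(q+1+k)^{k+1})`. [folklore] -/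
theorem elimination_step (a : ℕ → K) {q k : ℕ} (α : Fin (q + 2) → K)
    (hαlast : α (Fin.last (q + 1)) = 1) (hΔq : hankelDet a q ≠ 0)
    (hΔN : hankelDet a (q + 1 + k) = 0)
    (ih : ∀ j < q + 1 + k, ∑ i : Fin (q + 2), α i * a (i + j) = 0) :
    ∑ i : Fin (q + 2), α i * a (i + (q + 1 + k)) = 0 := by
  classical
  -- notation: `L`, `N`, the Hankel matrix `A`
  set L : ℕ → K := fun j => ∑ i : Fin (q + 2), α i * a (i + j) with hL
  change L (q + 1 + k) = 0
  have hLj : ∀ j < q + 1 + k, L j = 0 := ih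
  set N : ℕ := q + 1 + k with hN
  -- the matrix of row operations (identity on rows `≤ q`)
  let E : Matrix (Fin (N + 1)) (Fin (N + 1)) K := Matrix.of fun i l =>
    if (i : ℕ) ≤ q then (if i = l then 1 else 0)
    else ∑ t : Fin (q + 2), α t * (if (l : ℕ) = (t : ℕ) + i - (q + 1) then 1 else 0)
  have hE_apply : ∀ i l : Fin (N + 1), E i l =
      if (i : ℕ) ≤ q then (if i = l then 1 else 0)
      else ∑ t : Fin (q + 2), α t * (if (l : ℕ) = (t : ℕ) + i - (q + 1) then 1 else 0) :=
    fun i l => rfl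
  -- `E` is unit lower triangular, so `det E = 1`
  have hElow : E.BlockTriangular OrderDual.toDual := by
    intro i l hil
    have hil' : (i : ℕ) < l := OrderDual.toDual_lt_toDual.mp hil
    rw [hE_apply]
    split_ifs with h1 h2
    · exact absurd (congrArg Fin.val h2) (by omega)
    · rfl
    · refine Finset.sum_eq_zero fun t _ => ?_
      have := t.isLt
      rw [if_neg (by omega), mul_zero]
  have hEdiag : ∀ i : Fin (N + 1), E i i = 1 := by
    intro i
    rw [hE_apply]
    by_cases h1 : (i : ℕ) ≤ q
    · rw [if_pos h1, if_pos rfl]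
    · rw [if_neg h1, Fin.sum_univ_castSucc]
      have hlast : ((Fin.last (q + 1) : Fin (q + 2)) : ℕ) = q + 1 := rfl
      rw [hlast, if_pos (by omega), hαlast, mul_one, Finset.sum_eq_zero, zero_add]
      intro t _
      have := t.isLt
      rw [Fin.val_castSucc, if_neg (by omega), mul_zero]
  have hEdet : E.det = 1 := by
    rw [Matrix.det_of_lowerTriangular E hElow]
    simp [hEdiag]
  -- the row-reduced matrix `B = E * A` and its entries
  set A : Matrix (Fin (N + 1)) (Fin (N + 1)) K := hankelMatrix a N with hA
  set B : Matrix (Fin (N + 1)) (Fin (N + 1)) K := E * A with hB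
  have hB_top : ∀ i j : Fin (N + 1), (i : ℕ) ≤ q → B i j = a (i + j) := by
    intro i j hi
    rw [hB, Matrix.mul_apply]
    simp only [hE_apply, if_pos hi, hA, hankelMatrix_apply, ite_mul, one_mul, zero_mul,
      Finset.sum_ite_eq, Finset.mem_univ, if_true]
  have hB_bot : ∀ i j : Fin (N + 1), q < (i : ℕ) → B i j = L ((i : ℕ) - (q + 1) + j) := by
    intro i j hi
    rw [hB, Matrix.mul_apply]
    simp only [hE_apply, if_neg (not_le.mpr hi), hA, hankelMatrix_apply, Finset.sum_mul,
      mul_assoc, ite_mul, one_mul, zero_mul]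
    rw [Finset.sum_comm]
    refine Finset.sum_congr rfl fun t _ => ?_
    rw [← Finset.mul_sum]
    congr 1
    have ht := t.isLt
    have hi' := i.isLt
    have hidx : (t : ℕ) + i - (q + 1) < N + 1 := by omega
    rw [show (∑ l : Fin (N + 1), if (l : ℕ) = (t : ℕ) + i - (q + 1) then a ((l : ℕ) + j) else 0)
        = ∑ l : Fin (N + 1), if l = ⟨(t : ℕ) + i - (q + 1), hidx⟩ then a ((l : ℕ) + j) else 0 by
      refine Finset.sum_congr rfl fun l _ => ?_
      simp only [Fin.ext_iff]]
    rw [Finset.sum_ite_eq' Finset.univ, if_pos (Finset.mem_univ _)]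
    simp only
    congr 1
    omega
  -- reindex along `Fin (q+1) ⊕ Fin (k+1) ≃ Fin (N+1)` and read off the blocks
  have hNsum : q + 1 + (k + 1) = N + 1 := by omega
  let e : Fin (q + 1) ⊕ Fin (k + 1) ≃ Fin (N + 1) := finSumFinEquiv.trans (finCongr hNsum)
  have he_inl : ∀ i : Fin (q + 1), ((e (Sum.inl i) : Fin (N + 1)) : ℕ) = i := by
    intro i; simp [e]
  have he_inr : ∀ t : Fin (k + 1), ((e (Sum.inr t) : Fin (N + 1)) : ℕ) = q + 1 + t := by
    intro t; simp [e]
  set B' : Matrix (Fin (q + 1) ⊕ Fin (k + 1)) (Fin (q + 1) ⊕ Fin (k + 1)) K :=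
    B.submatrix e e with hB'
  have h11 : B'.toBlocks₁₁ = hankelMatrix a q := by
    ext i j
    simp only [hB', Matrix.toBlocks₁₁, Matrix.of_apply, Matrix.submatrix_apply,
      hankelMatrix_apply]
    rw [hB_top _ _ (by rw [he_inl]; have := i.isLt; omega), he_inl, he_inl]
  have h21 : B'.toBlocks₂₁ = 0 := by
    ext t j
    simp only [hB', Matrix.toBlocks₂₁, Matrix.of_apply, Matrix.submatrix_apply,
      Matrix.zero_apply]
    rw [hB_bot _ _ (by rw [he_inr]; omega), he_inr, he_inl]
    apply hLj
    have := t.isLt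
    have := j.isLt
    omega
  set D : Matrix (Fin (k + 1)) (Fin (k + 1)) K := B'.toBlocks₂₂ with hD
  have hD_apply : ∀ t u : Fin (k + 1), D t u = L (q + 1 + ((t : ℕ) + u)) := by
    intro t u
    simp only [hD, hB', Matrix.toBlocks₂₂, Matrix.of_apply, Matrix.submatrix_apply]
    rw [hB_bot _ _ (by rw [he_inr]; omega), he_inr, he_inr]
    congr 1
    omega
  -- determinants
  have hsplit : B' = Matrix.fromBlocks (hankelMatrix a q) B'.toBlocks₁₂ 0 D := by
    rw [← h11, ← h21, hD, Matrix.fromBlocks_toBlocks]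
  have hdetB' : B'.det = hankelDet a q * D.det := by
    rw [hsplit, Matrix.det_fromBlocks_zero₂₁, hankelDet]
  have hdetB : B'.det = 0 := by
    rw [hB', Matrix.det_submatrix_equiv_self, hB, Matrix.det_mul, hEdet, one_mul, hA]
    exact hΔN
  have hDdet : D.det = 0 := by
    rw [hdetB'] at hdetB
    exact (mul_eq_zero.mp hdetB).resolve_left hΔq
  -- the anti-triangular step with `c s = L (q+1+s)`
  exact eq_zero_of_det_antitriangular (fun s => L (q + 1 + s))
    (fun s hs => hLj _ (by omega)) D hD_apply hDdet

/-- **Kronecker's rationality criterion, recurrence form** (Kronecker 1881; Salem's lemma).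
If the Hankel determinants `Δₘ = det(a_{i+j})_{0≤i,j≤m}` of a sequence over a field vanish for
all `m ≥ m₁`, then the sequence satisfies a linear recurrence with constant coefficients and
leading coefficient `1`: there are `p` and `α₀, …, α_p` with `α_p = 1` and
`Σ_{i=0}^{p} αᵢ a_{i+j} = 0` for every `j ≥ 0`. [folklore] -/
theorem exists_recurrence_of_hankelDet_eq_zero (a : ℕ → K) {m₁ : ℕ}
    (h : ∀ m, m₁ ≤ m → hankelDet a m = 0) :
    ∃ p : ℕ, ∃ α : Fin (p + 1) → K, α (Fin.last p) = 1 ∧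
      ∀ j : ℕ, ∑ i : Fin (p + 1), α i * a (i + j) = 0 := by
  classical
  have hex : ∃ p, ∀ m, p ≤ m → hankelDet a m = 0 := ⟨m₁, h⟩
  -- the least such `p`
  obtain ⟨p, hp, hmin⟩ : ∃ p, (∀ m, p ≤ m → hankelDet a m = 0) ∧
      ∀ p' < p, ¬ ∀ m, p' ≤ m → hankelDet a m = 0 :=
    ⟨Nat.find hex, Nat.find_spec hex, fun p' hp' => Nat.find_min hex hp'⟩
  rcases Nat.eq_zero_or_pos p with rfl | hppos
  · -- all determinants vanish: the sequence is identically zero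
    have hzero : ∀ j, a j = 0 := by
      intro j
      induction j using Nat.strong_induction_on with
      | _ m ih =>
        exact eq_zero_of_det_antitriangular a ih (hankelMatrix a m) (fun t u => rfl)
          (hp m (Nat.zero_le m))
    refine ⟨0, fun _ => 1, rfl, fun j => ?_⟩
    simp [hzero]
  · -- `p = q + 1` and `Δ_q ≠ 0`
    obtain ⟨q, rfl⟩ : ∃ q, p = q + 1 := ⟨p - 1, by omega⟩
    have hΔq : hankelDet a q ≠ 0 := by
      intro hzero
      refine hmin q (by omega) fun m hm => ?_
      rcases Nat.eq_or_lt_of_le hm with rfl | hlt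
      · exact hzero
      · exact hp m (by omega)
    -- a vanishing linear combination of the rows of the `(q+2) × (q+2)` Hankel matrix
    have hdep : (hankelMatrix a (q + 1)).det = 0 := hp (q + 1) le_rfl
    obtain ⟨v, hv0, hv⟩ := Matrix.exists_vecMul_eq_zero_iff.mpr hdep
    have hvj : ∀ j : Fin (q + 2), ∑ i : Fin (q + 2), v i * a (i + j) = 0 := by
      intro j
      have := congr_fun hv j
      simpa [Matrix.vecMul, dotProduct] using this
    -- its last coefficient is non-zero (else `Δ_q = 0`)
    have hvlast : v (Fin.last (q + 1)) ≠ 0 := by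
      intro hzero
      apply hΔq
      apply (Matrix.exists_vecMul_eq_zero_iff (M := hankelMatrix a q)).mp
      refine ⟨fun i => v (Fin.castSucc i), ?_, ?_⟩
      · intro hw
        apply hv0
        funext i
        rcases Fin.eq_castSucc_or_eq_last i with ⟨i', rfl⟩ | rfl
        · exact congr_fun hw i'
        · exact hzero
      · funext j
        simp only [Matrix.vecMul, dotProduct, Pi.zero_apply, hankelMatrix_apply]
        have := hvj (Fin.castSucc j)
        rw [Fin.sum_univ_castSucc] at this
        simpa [hzero] using this
    -- normalise the last coefficient to `1`
    refine ⟨q + 1, fun i => v i / v (Fin.last (q + 1)), div_self hvlast, ?_⟩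
    have hαj : ∀ j : ℕ, j ≤ q + 1 →
        ∑ i : Fin (q + 2), v i / v (Fin.last (q + 1)) * a (i + j) = 0 := by
      intro j hj
      have := hvj ⟨j, by omega⟩
      simp only [div_mul_eq_mul_div, ← Finset.sum_div, this, zero_div]
    intro n
    induction n using Nat.strong_induction_on with
    | _ n ih =>
      rcases Nat.lt_or_ge n (q + 2) with hn | hn
      · exact hαj n (by omega)
      · obtain ⟨k, rfl⟩ : ∃ k, n = q + 1 + k := ⟨n - (q + 1), by omega⟩
        exact elimination_step a _ (div_self hvlast) hΔq (hp _ (by omega))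
          (fun j hj => ih j hj)

/-- **Kronecker's rationality criterion, power-series form.** If `Δₘ = 0` for all `m ≥ m₁`,
then `f = Σ aₙ xⁿ ∈ K⟦x⟧` is rational: there are polynomials `Q ≠ 0` and `P` with `Q · f = P`
(indeed `Q = Σ_{i ≤ p} αᵢ x^{p−i}` from the recurrence, `Q(0) = α_p = 1`, and `deg P < p`).
[folklore] -/
theorem exists_polynomial_mul_eq_of_hankelDet_eq_zero (a : ℕ → K) {m₁ : ℕ}
    (h : ∀ m, m₁ ≤ m → hankelDet a m = 0) :
    ∃ Q : Polynomial K, Q ≠ 0 ∧ ∃ P : Polynomial K,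
      (Q : PowerSeries K) * PowerSeries.mk a = (P : PowerSeries K) := by
  classical
  obtain ⟨p, α, hαp, hrec⟩ := exists_recurrence_of_hankelDet_eq_zero a h
  -- `Q = Σ αᵢ x^{p-i}`
  set Q : Polynomial K := ∑ i : Fin (p + 1), Polynomial.monomial (p - i) (α i) with hQ
  have hQcoeff0 : Q.coeff 0 = 1 := by
    rw [hQ, Polynomial.finsetSum_coeff]
    simp only [Polynomial.coeff_monomial]
    rw [Finset.sum_eq_single (Fin.last p)]
    · simp [hαp]
    · intro i _ hi
      have : (i : ℕ) < p := by
        have h1 := i.isLt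
        have h2 : (i : ℕ) ≠ p := fun heq => hi (Fin.ext (by simp [heq]))
        omega
      rw [if_neg (by omega)]
    · intro hnot; exact absurd (Finset.mem_univ _) hnot
  have hQ0 : Q ≠ 0 := by
    intro hzero
    rw [hzero, Polynomial.coeff_zero] at hQcoeff0
    exact zero_ne_one hQcoeff0
  -- the coefficients of `Q * f` vanish from degree `p` on
  set g : PowerSeries K := (Q : PowerSeries K) * PowerSeries.mk a with hg
  have hQcoe : (Q : PowerSeries K) = ∑ t : Fin (p + 1), PowerSeries.monomial (p - t) (α t) := by
    rw [hQ]
    have := map_sum (Polynomial.coeToPowerSeries.ringHom : Polynomial K →+* PowerSeries K)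
      (fun t : Fin (p + 1) => Polynomial.monomial (p - t) (α t)) Finset.univ
    simpa only [Polynomial.coeToPowerSeries.ringHom_apply, Polynomial.coe_monomial] using this
  have hcoeff : ∀ n, p ≤ n → PowerSeries.coeff n g = 0 := by
    intro n hn
    rw [hg, hQcoe, Finset.sum_mul, map_sum]
    simp only [PowerSeries.monomial_eq_C_mul_X_pow, mul_assoc, PowerSeries.coeff_C_mul,
      PowerSeries.coeff_X_pow_mul', PowerSeries.coeff_mk]
    rw [← hrec (n - p)]
    refine Finset.sum_congr rfl fun t _ => ?_
    have := t.isLt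
    rw [if_pos (by omega)]
    congr 2
    omega
  refine ⟨Q, hQ0, PowerSeries.trunc p g, ?_⟩
  ext n
  rw [Polynomial.coeff_coe, PowerSeries.coeff_trunc]
  split_ifs with hn
  · rfl
  · exact hcoeff n (not_lt.mp hn)

end Field

end Kronecker

end Literature.NumberTheory.Transcendental
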